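import Summits.AtomisticToContinuum.FouriersLaw.Theses.ParityLiouvilleSeed

/-!
# `ParityLiouvilleSeed.Assembly` — PROVED

Route `AtomisticToContinuum/FouriersLaw/ParityLiouvilleSeed`, assembly item
`stmt-AtomisticToContinuum-13983` (`Assembly`):

  `NessUnique → PinnedSteadyStateExists → FiniteResponseOfUnique → PositiveConductance →
   ConductanceLowerBound → SuperadditiveResistance → SuperadditiveFekete → ZeroCurrentRigidity →
   NessRegularity → NessTightness → WindowLimit → CesaroUpgrade → UniformLinearRegime → FouriersLaw`.

The route file carries the planner-authored, sorry-free D-0027 §2.1 deciding theorem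
`Summit.AtomisticToContinuum.FouriersLaw.Theses.ParityLiouvilleSeed.closes`, whose type is literally
the body of `Assembly`; this file records the item-closing theorem whose type is the route decl
`Assembly` by name.  For the mathematics (STEP A: the anti-ballistic rung at fixed temperatures from
`WindowLimit` + `CesaroUpgrade hZ : LiouvilleForHeat`, with `NessTightness` / `NessRegularity`
supplying the a-priori inputs; STEP B: not-ballistic at linear response from the rung and
`UniformLinearRegime`, then `SuperadditiveFekete` with `PositiveConductance`,
`ConductanceLowerBound`, `SuperadditiveResistance`; STEP C: transfer to every steady family by
`NessUnique`; clause (i) from `PinnedSteadyStateExists` + `NessUnique`) see the proof of `closes` in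
the route file.  No named-fact hypotheses: the theorem is unconditional (its axioms are those of
`closes`: `propext`, `Classical.choice`, `Quot.sound`).
-/

namespace Summit.AtomisticToContinuum.FouriersLaw.Theorems

/-- Settles `stmt-AtomisticToContinuum-13983` (assembly of route `ParityLiouvilleSeed`): the frame
items `NessUnique`, `PinnedSteadyStateExists`, `FiniteResponseOfUnique`, the junction half
`PositiveConductance`, `ConductanceLowerBound`, `SuperadditiveResistance`, `SuperadditiveFekete`,
the rigidity half `ZeroCurrentRigidity`, `NessRegularity`, `NessTightness`, `WindowLimit`,
`CesaroUpgrade` and the bridge `UniformLinearRegime` imply the sub-problem statement `FouriersLaw`.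
Proof: the route's deciding theorem `closes` (after unfolding `Assembly`). [folklore] -/
theorem parityLiouvilleSeed_assembly_proof :
    Summit.AtomisticToContinuum.FouriersLaw.Theses.ParityLiouvilleSeed.Assembly := by
  unfold Summit.AtomisticToContinuum.FouriersLaw.Theses.ParityLiouvilleSeed.Assembly
  exact Summit.AtomisticToContinuum.FouriersLaw.Theses.ParityLiouvilleSeed.closes

end Summit.AtomisticToContinuum.FouriersLaw.Theorems
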